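import Summits.AtomisticToContinuum.FouriersLaw.Theorems.HonestZwanzigRobinCoercivityFluxReduction

/-!
# `HonestZwanzig.RobinCoercivity` from row-summability of the Laplace–Gram matrix of temperature gradients (line LinAlg)

Support file for the crux `stmt-AtomisticToContinuum-12695` (`RobinCoercivity` of route `HonestZwanzig`, sub-problem
`FouriersLaw`): the working sufficient condition C⁺⁺ of card `gradient-gram-schur-test`. With `χ = Cov(e,e)`,
`G_N(s) = [lap_s(e_x,e_y)]` and the Robin incidence matrix `B` on `Fin N ⊕ Fin 2`, the Laplace–GRAM matrix of the
`N + 1` thermodynamic-gradient observables (plus one identically zero row) is `Γ_N(s) = B χ⁻¹ G_N(s) χ⁻¹ Bᵀ`.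

* `quadForm_le_of_rowSum` — Schur's row test: a symmetric matrix with `Σ_β |Γ_αβ| ≤ K` has `wᵀΓw ≤ K|w|²`.
* `fluxBound_of_rowSum` — pure matrix algebra: row-summability of `Γ` gives the flux bound `aᵀGa ≤ K|w|²` whenever
  `χa = Bᵀw` (`χ` positive definite, `G` symmetric).
* `rowSum_fixedN` — the same at the route's gadgets (fixed `N`, `s`; abstract `lap, cov, e` with defining equations).
* `robinCoercivity_of_rowSummableGram` — hence `RobinCoercivity` follows from an N-UNIFORM bound on the row sums of
  `Γ_N(s)` for small `s`, through the landed `robinCoercivity_of_fluxBound`. This is the property the equilibrium-MD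
  evidence on the item tests entry by entry (bounded diagonal = each temperature gradient has `O(1)` time-integrated
  variance; summable off-diagonal entries = locality).
-/

noncomputable section

open MeasureTheory Finset Matrix
open Literature.MathematicalPhysics.KineticTheory.HeatConduction
open Summit.AtomisticToContinuum.FouriersLaw.Theses.HonestZwanzig
open Summit.AtomisticToContinuum.FouriersLaw.Theorems.HonestZwanzig.NetworkReduction

namespace Summit.AtomisticToContinuum.FouriersLaw.Theorems.HonestZwanzig.Robin

/-! ### Schur's row test -/

/-- **Schur's row test.** For a symmetric real matrix with `Σ_β |Γ_αβ| ≤ K` for every row `α`: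
`wᵀ Γ w ≤ K |w|²`. -/
theorem quadForm_le_of_rowSum {m : Type*} [Fintype m] (Γ : Matrix m m ℝ) (hsymm : ∀ α β', Γ α β' = Γ β' α)
    {K : ℝ} (hrow : ∀ α, ∑ β', |Γ α β'| ≤ K) (w : m → ℝ) :
    w ⬝ᵥ (Γ *ᵥ w) ≤ K * (w ⬝ᵥ w) := by
  have h1 : w ⬝ᵥ (Γ *ᵥ w) = ∑ α, ∑ β', w α * Γ α β' * w β' := by
    rw [← sum_sum_eq_dotProduct_mulVec]
  have h2 : ∀ α β', w α * Γ α β' * w β' ≤ w α ^ 2 * |Γ α β'| / 2 + w β' ^ 2 * |Γ α β'| / 2 := by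
    intro α β'
    have habs : w α * Γ α β' * w β' ≤ |Γ α β'| * (|w α| * |w β'|) := by
      rw [show w α * Γ α β' * w β' = Γ α β' * (w α * w β') by ring, ← abs_mul (w α)]
      calc Γ α β' * (w α * w β') ≤ |Γ α β' * (w α * w β')| := le_abs_self _
        _ = |Γ α β'| * |w α * w β'| := abs_mul _ _
    have hamgm : |w α| * |w β'| ≤ (w α ^ 2 + w β' ^ 2) / 2 := by
      nlinarith [sq_nonneg (|w α| - |w β'|), sq_abs (w α), sq_abs (w β')]
    have := mul_le_mul_of_nonneg_left hamgm (abs_nonneg (Γ α β'))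
    nlinarith [this, habs]
  have h3 : ∑ α, ∑ β', w α * Γ α β' * w β' ≤
      ∑ α, ∑ β', (w α ^ 2 * |Γ α β'| / 2 + w β' ^ 2 * |Γ α β'| / 2) :=
    Finset.sum_le_sum fun α _ => Finset.sum_le_sum fun β' _ => h2 α β'
  have h4 : ∑ α, ∑ β', (w α ^ 2 * |Γ α β'| / 2 + w β' ^ 2 * |Γ α β'| / 2) =
      (∑ α, w α ^ 2 * ∑ β', |Γ α β'|) / 2 + (∑ β', w β' ^ 2 * ∑ α, |Γ α β'|) / 2 := by
    simp only [Finset.sum_add_distrib]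
    congr 1
    · rw [Finset.sum_div]
      refine Finset.sum_congr rfl fun α _ => ?_
      rw [Finset.mul_sum, Finset.sum_div]
    · rw [Finset.sum_comm, Finset.sum_div]
      refine Finset.sum_congr rfl fun β' _ => ?_
      rw [Finset.mul_sum, Finset.sum_div]
  have hcol : ∀ β', ∑ α, |Γ α β'| ≤ K := by
    intro β'
    calc ∑ α, |Γ α β'| = ∑ α, |Γ β' α| := Finset.sum_congr rfl fun α _ => by rw [hsymm]
      _ ≤ K := hrow β'
  have h5 : ∑ α, w α ^ 2 * ∑ β', |Γ α β'| ≤ ∑ α, w α ^ 2 * K :=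
    Finset.sum_le_sum fun α _ => mul_le_mul_of_nonneg_left (hrow α) (sq_nonneg _)
  have h6 : ∑ β', w β' ^ 2 * ∑ α, |Γ α β'| ≤ ∑ β', w β' ^ 2 * K :=
    Finset.sum_le_sum fun β' _ => mul_le_mul_of_nonneg_left (hcol β') (sq_nonneg _)
  have hww : w ⬝ᵥ w = ∑ α, w α ^ 2 := by
    simp only [dotProduct, sq]
  rw [h1, hww]
  rw [← Finset.sum_mul] at h5 h6
  linarith [h3, h4, h5, h6]

/-! ### Row-summability of `Γ = B χ⁻¹ G χ⁻¹ Bᵀ` gives the flux bound -/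

/-- **Flux bound from row-summability of the Gram matrix** (pure matrix algebra): if `χ` is positive definite, `G`
symmetric and `Γ = B χ⁻¹ G χ⁻¹ Bᵀ` has rows with `Σ_β |Γ_αβ| ≤ K`, then `aᵀGa ≤ K|w|²` whenever `χa = Bᵀw`. -/
theorem fluxBound_of_rowSum {m n : Type*} [Fintype m] [Fintype n] [DecidableEq n]
    (B : Matrix m n ℝ) (G χ : Matrix n n ℝ) (hχ : χ.PosDef) (hGs : ∀ x y, G x y = G y x) {K : ℝ}
    (hrow : ∀ α, ∑ β', |(B * χ⁻¹ * G * χ⁻¹ * Bᵀ) α β'| ≤ K)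
    (a : n → ℝ) (w : m → ℝ) (haw : χ *ᵥ a = Bᵀ *ᵥ w) :
    a ⬝ᵥ (G *ᵥ a) ≤ K * (w ⬝ᵥ w) := by
  have hχu : IsUnit χ.det := (Matrix.isUnit_iff_isUnit_det χ).1 hχ.isUnit
  have hχs : χᵀ = χ := by
    have h := hχ.isHermitian
    rw [Matrix.IsHermitian, Matrix.conjTranspose_eq_transpose_of_trivial] at h
    exact h
  have hχis : (χ⁻¹)ᵀ = χ⁻¹ := by rw [Matrix.transpose_nonsing_inv, hχs]
  have hGt : Gᵀ = G := by ext x y; exact hGs y x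
  -- `a = χ⁻¹ Bᵀ w`
  have ha : a = χ⁻¹ *ᵥ (Bᵀ *ᵥ w) := by
    rw [← haw, Matrix.mulVec_mulVec, Matrix.nonsing_inv_mul χ hχu, Matrix.one_mulVec]
  -- symmetry of `Γ`
  set Γ : Matrix m m ℝ := B * χ⁻¹ * G * χ⁻¹ * Bᵀ with hΓ
  have hΓt : Γᵀ = Γ := by
    simp only [hΓ, Matrix.transpose_mul, Matrix.transpose_transpose, hχis, hGt, Matrix.mul_assoc]
  have hΓs : ∀ α β', Γ α β' = Γ β' α := fun α β' => by
    rw [← Matrix.transpose_apply Γ α β', hΓt]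
  -- `aᵀ G a = wᵀ Γ w`
  have hquad : a ⬝ᵥ (G *ᵥ a) = w ⬝ᵥ (Γ *ᵥ w) := by
    have e1 : Γ *ᵥ w = B *ᵥ (χ⁻¹ *ᵥ (G *ᵥ a)) := by
      rw [ha]
      simp only [hΓ, ← Matrix.mulVec_mulVec]
    rw [e1, Matrix.dotProduct_mulVec w B, ← Matrix.mulVec_transpose B w,
      Matrix.dotProduct_mulVec _ χ⁻¹, ← Matrix.mulVec_transpose χ⁻¹, hχis, ← ha]
  rw [hquad]
  exact quadForm_le_of_rowSum Γ hΓs hrow w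

/-! ### Fixed `N` and `s` at the route's gadgets -/

section FixedN

variable {ω₂ lam β γ : ℝ} {N : ℕ} {T : ℝ}
  {Adm : (PhaseSpace N → ℝ) → Prop}
  {corr : (PhaseSpace N → ℝ) → (PhaseSpace N → ℝ) → ℝ → ℝ}
  {lap : ℝ → (PhaseSpace N → ℝ) → (PhaseSpace N → ℝ) → ℝ}
  {cov : (PhaseSpace N → ℝ) → (PhaseSpace N → ℝ) → ℝ}
  {e : Fin N → PhaseSpace N → ℝ}
  (hAdm : ∀ f, Adm f ↔ (Continuous f ∧ ∃ A : ℝ, ∀ z,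
    |f z| ≤ A * Real.exp ((pinnedChain ω₂ lam β γ).hamiltonian N z / (8 * T))))
  (hcorr : ∀ f g t, corr f g t =
    (∫ z, f z * (∫ y, g y ∂((pinnedChain ω₂ lam β γ).transitionKernel N T T t.toNNReal z))
      ∂(pinnedChain ω₂ lam β γ).gibbsMeasure N T) -
    (∫ z, f z ∂(pinnedChain ω₂ lam β γ).gibbsMeasure N T) *
      (∫ z, g z ∂(pinnedChain ω₂ lam β γ).gibbsMeasure N T))
  (hlap : ∀ s f g, lap s f g = ∫ t in Set.Ioi (0 : ℝ), Real.exp (-(s * t)) * corr f g t)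
  (hcov : ∀ f g, cov f g = (∫ z, f z * g z ∂(pinnedChain ω₂ lam β γ).gibbsMeasure N T) -
    (∫ z, f z ∂(pinnedChain ω₂ lam β γ).gibbsMeasure N T) *
      (∫ z, g z ∂(pinnedChain ω₂ lam β γ).gibbsMeasure N T))
  (he : ∀ x z, e x z = z.2 x ^ 2 / 2 + (pinnedChain ω₂ lam β γ).U (z.1 x) +
    ∑ j : Fin N, ((if j.val = x.val + 1 then (pinnedChain ω₂ lam β γ).V (z.1 j - z.1 x) / 2 else 0) +
      (if x.val = j.val + 1 then (pinnedChain ω₂ lam β γ).V (z.1 x - z.1 j) / 2 else 0)))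
  (hFI : ∀ f g : PhaseSpace N → ℝ, Adm f → Adm g →
    Integrable f ((pinnedChain ω₂ lam β γ).gibbsMeasure N T) ∧
    (∀ t : ℝ, 0 ≤ t → Integrable (fun z => f z *
      (∫ y, g y ∂((pinnedChain ω₂ lam β γ).transitionKernel N T T t.toNNReal z)))
      ((pinnedChain ω₂ lam β γ).gibbsMeasure N T)) ∧
    IntegrableOn (corr f g) (Set.Ioi 0) ∧
    (∀ t : ℝ, 0 ≤ t → corr f g t = corr (fun z => g (z.1, -z.2)) (fun z => f (z.1, -z.2)) t) ∧
    (∀ s : ℝ, 0 < s → ∀ x : Fin N,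
      s * lap s (e x) g - cov (e x) g =
        lap s (fun z => (pinnedChain ω₂ lam β γ).generator N T T (e x) (z.1, -z.2)) g ∧
      s * lap s f (e x) - cov f (e x) = lap s f ((pinnedChain ω₂ lam β γ).generator N T T (e x))))
  (hGSE : ∀ (x : Fin N) (z : PhaseSpace N), (pinnedChain ω₂ lam β γ).generator N T T (e x) z =
    (∑ b : Fin N, ((if x.val = b.val + 1 then (pinnedChain ω₂ lam β γ).bondCurrent N b z else 0) -
      (if b = x then (pinnedChain ω₂ lam β γ).bondCurrent N b z else 0))) +
    (if x.val = 0 then (pinnedChain ω₂ lam β γ).γ * (T - z.2 x ^ 2) else 0) +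
    (if x.val = N - 1 then (pinnedChain ω₂ lam β γ).γ * (T - z.2 x ^ 2) else 0))
  (hPS : ∀ x y : Fin N, cov (e x) ((pinnedChain ω₂ lam β γ).generator N T T (e y)) =
    -(if x = y ∧ (x.val = 0 ∨ x.val = N - 1) then (pinnedChain ω₂ lam β γ).γ * T ^ 2 else 0))
  (hω : 0 < ω₂) (hl : 0 ≤ lam) (hβ : 0 ≤ β) (hγ : 0 ≤ γ) (hT : 0 < T)

include hAdm hlap hcov hFI he hω hl hβ hT in
/-- **The flux bound at fixed `N` and `s` from row-summability of `Γ_N(s)`** (route gadgets; fixed-`N` package for the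
symmetry of `G(s)`, positivity of `Cov(e,e)`). -/
theorem rowSum_fixedN (hN : 2 ≤ N) (s : ℝ)
    (hCp : ∀ v : Fin N → ℝ, v ≠ 0 → 0 < ∑ x, ∑ y, v x * cov (e x) (e y) * v y) {K : ℝ}
    (hrow : ∀ α : Fin N ⊕ Fin 2,
      ∑ β' : Fin N ⊕ Fin 2, |((Matrix.of fun (r : Fin N ⊕ Fin 2) (x : Fin N) => Sum.elim
          (fun b : Fin N => if x.val = b.val + 1 then (1 : ℝ) else if x = b ∧ b.val + 1 < N then -1 else 0)
          (fun i : Fin 2 => if (i = 0 ∧ x.val = 0) ∨ (i = 1 ∧ x.val = N - 1) then (1 : ℝ) else 0) r) *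
        (Matrix.of fun x y => cov (e x) (e y))⁻¹ * (Matrix.of fun x y => lap s (e x) (e y)) *
        (Matrix.of fun x y => cov (e x) (e y))⁻¹ *
        (Matrix.of fun (r : Fin N ⊕ Fin 2) (x : Fin N) => Sum.elim
          (fun b : Fin N => if x.val = b.val + 1 then (1 : ℝ) else if x = b ∧ b.val + 1 < N then -1 else 0)
          (fun i : Fin 2 => if (i = 0 ∧ x.val = 0) ∨ (i = 1 ∧ x.val = N - 1) then (1 : ℝ) else 0) r)ᵀ) α β'| ≤ K)
    (a ψ : Fin N → ℝ) (φ₀ φ₁ : ℝ)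
    (hdiv : ∀ x : Fin N, ∑ y : Fin N, cov (e x) (e y) * a y =
        (∑ b : Fin N, if b.val + 1 < N then
          ((if x.val = b.val + 1 then ψ b else 0) - (if x = b then ψ b else 0)) else 0) +
        (if x.val = 0 then φ₀ else 0) + (if x.val = N - 1 then φ₁ else 0)) :
    ∑ x : Fin N, ∑ y : Fin N, a x * lap s (e x) (e y) * a y ≤
      K * ((∑ b : Fin N, if b.val + 1 < N then ψ b ^ 2 else 0) + φ₀ ^ 2 + φ₁ ^ 2) := by
  classical
  set χ : Matrix (Fin N) (Fin N) ℝ := Matrix.of fun x y => cov (e x) (e y) with hχ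
  set Gm : Matrix (Fin N) (Fin N) ℝ := Matrix.of fun x y => lap s (e x) (e y) with hGm
  have hχa : ∀ x y, χ x y = cov (e x) (e y) := fun x y => rfl
  have hGa : ∀ x y, Gm x y = lap s (e x) (e y) := fun x y => rfl
  have hGsym : ∀ x y, Gm x y = Gm y x := fun x y => by
    rw [hGa, hGa, pkg_G_symm hAdm hlap he hFI hω hl hβ hT s]
  have hχsym : ∀ x y, χ x y = χ y x := fun x y => by rw [hχa, hχa, cov_comm hcov]
  have hχpd : χ.PosDef := posDef_of_symm_of_pos χ hχsym (fun v hv => by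
    simpa only [hχa] using hCp v hv)
  set B : Matrix (Fin N ⊕ Fin 2) (Fin N) ℝ := (Matrix.of fun (r : Fin N ⊕ Fin 2) (x : Fin N) => Sum.elim
          (fun b : Fin N => if x.val = b.val + 1 then (1 : ℝ) else if x = b ∧ b.val + 1 < N then -1 else 0)
          (fun i : Fin 2 => if (i = 0 ∧ x.val = 0) ∨ (i = 1 ∧ x.val = N - 1) then (1 : ℝ) else 0) r) with hBdef
  obtain ⟨-, hBdiv, hBnorm⟩ := stub_robinIncidence hN B (fun r x => rfl)
  set ψ' : Fin N → ℝ := fun b => if b.val + 1 < N then ψ b else 0 with hψ'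
  set w : Fin N ⊕ Fin 2 → ℝ := Sum.elim ψ' ![φ₀, φ₁] with hw
  have hψ'v : ∀ b : Fin N, b.val + 1 < N → ψ' b = ψ b := fun b hb => by simp only [hψ', if_pos hb]
  have haw : χ *ᵥ a = Bᵀ *ᵥ w := by
    funext x
    rw [hw, hBdiv ψ' ![φ₀, φ₁] x]
    have h1 : (χ *ᵥ a) x = ∑ y : Fin N, cov (e x) (e y) * a y := by
      simp only [Matrix.mulVec, dotProduct, hχa]
    rw [h1, hdiv x]
    simp only [Matrix.cons_val_zero, Matrix.cons_val_one]
    congr 1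
    congr 1
    refine Finset.sum_congr rfl fun b _ => ?_
    by_cases hb : b.val + 1 < N
    · rw [if_pos hb, if_pos hb, hψ'v b hb]
    · rw [if_neg hb, if_neg hb]
  have key := fluxBound_of_rowSum B Gm χ hχpd hGsym hrow a w haw
  have hlhs : a ⬝ᵥ (Gm *ᵥ a) = ∑ x : Fin N, ∑ y : Fin N, a x * lap s (e x) (e y) * a y := by
    rw [← sum_sum_eq_dotProduct_mulVec]
    rfl
  have hrhs : w ⬝ᵥ w = (∑ b : Fin N, if b.val + 1 < N then ψ b ^ 2 else 0) + φ₀ ^ 2 + φ₁ ^ 2 := by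
    rw [hw, hBnorm ψ' ![φ₀, φ₁]]
    simp only [Matrix.cons_val_zero, Matrix.cons_val_one]
    congr 1
    congr 1
    refine Finset.sum_congr rfl fun b _ => ?_
    by_cases hb : b.val + 1 < N
    · rw [if_pos hb, hψ'v b hb]
    · rw [if_neg hb]
      simp only [hψ', if_neg hb]
      ring
  rw [hlhs, hrhs] at key
  exact key

end FixedN

/-! ### The crux from N-uniform row-summability -/

/-- **`RobinCoercivity` from an N-uniform bound on the row sums of the Laplace–Gram matrix of temperature gradients**
(C⁺⁺ of card `gradient-gram-schur-test`): if there is `K` such that for every `N ≥ 2` and all small `s > 0` every row of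
`Γ_N(s) = B Cov(e,e)⁻¹ G_N(s) Cov(e,e)⁻¹ Bᵀ` has absolute sum at most `K`, then the crux holds (with `c = K⁻¹`). -/
theorem robinCoercivity_of_rowSummableGram (hrowN : ∀ ω₂ lam β γ : ℝ, 0 < ω₂ → 0 < lam → 0 < β → 0 < γ → ∀ T : ℝ, 0 < T →
    ∃ K : ℝ, 0 < K ∧ ∀ N : ℕ, 2 ≤ N → ∃ s₀ : ℝ, 0 < s₀ ∧
    ∀ (lap : ℝ → (PhaseSpace N → ℝ) → (PhaseSpace N → ℝ) → ℝ)
      (cov : (PhaseSpace N → ℝ) → (PhaseSpace N → ℝ) → ℝ) (e : Fin N → PhaseSpace N → ℝ),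
    (∀ s f g, lap s f g = ∫ t in Set.Ioi (0 : ℝ), Real.exp (-(s * t)) *
      ((∫ z, f z * (∫ y, g y ∂((pinnedChain ω₂ lam β γ).transitionKernel N T T t.toNNReal z))
          ∂(pinnedChain ω₂ lam β γ).gibbsMeasure N T) -
        (∫ z, f z ∂(pinnedChain ω₂ lam β γ).gibbsMeasure N T) *
          (∫ z, g z ∂(pinnedChain ω₂ lam β γ).gibbsMeasure N T))) →
    (∀ f g, cov f g = (∫ z, f z * g z ∂(pinnedChain ω₂ lam β γ).gibbsMeasure N T) -
      (∫ z, f z ∂(pinnedChain ω₂ lam β γ).gibbsMeasure N T) *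
        (∫ z, g z ∂(pinnedChain ω₂ lam β γ).gibbsMeasure N T)) →
    (∀ x z, e x z = z.2 x ^ 2 / 2 + (pinnedChain ω₂ lam β γ).U (z.1 x) +
      ∑ j : Fin N, ((if j.val = x.val + 1 then (pinnedChain ω₂ lam β γ).V (z.1 j - z.1 x) / 2 else 0) +
        (if x.val = j.val + 1 then (pinnedChain ω₂ lam β γ).V (z.1 x - z.1 j) / 2 else 0))) →
    ∀ s : ℝ, 0 < s → s < s₀ → ∀ α : Fin N ⊕ Fin 2,
      ∑ β' : Fin N ⊕ Fin 2, |((Matrix.of fun (r : Fin N ⊕ Fin 2) (x : Fin N) => Sum.elim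
          (fun b : Fin N => if x.val = b.val + 1 then (1 : ℝ) else if x = b ∧ b.val + 1 < N then -1 else 0)
          (fun i : Fin 2 => if (i = 0 ∧ x.val = 0) ∨ (i = 1 ∧ x.val = N - 1) then (1 : ℝ) else 0) r) *
        (Matrix.of fun x y => cov (e x) (e y))⁻¹ * (Matrix.of fun x y => lap s (e x) (e y)) *
        (Matrix.of fun x y => cov (e x) (e y))⁻¹ *
        (Matrix.of fun (r : Fin N ⊕ Fin 2) (x : Fin N) => Sum.elim
          (fun b : Fin N => if x.val = b.val + 1 then (1 : ℝ) else if x = b ∧ b.val + 1 < N then -1 else 0)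
          (fun i : Fin 2 => if (i = 0 ∧ x.val = 0) ∨ (i = 1 ∧ x.val = N - 1) then (1 : ℝ) else 0) r)ᵀ) α β'| ≤ K) :
    RobinCoercivity := by
  refine robinCoercivity_of_fluxBound ?_
  intro ω₂ lam β γ hω hl hβ hγ T hT
  obtain ⟨K, hK, hKN⟩ := hrowN ω₂ lam β γ hω hl hβ hγ T hT
  refine ⟨K, hK, fun N hN => ?_⟩
  obtain ⟨s₀, hs₀, hrow⟩ := hKN N hN
  refine ⟨s₀, hs₀, ?_⟩
  intro lap cov e hlap hcov he s hs hss a ψ φ₀ φ₁ hdiv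
  have hrow' := hrow lap cov e hlap hcov he s hs hss
  obtain rfl : lap = fun s f g => ∫ t in Set.Ioi (0 : ℝ), Real.exp (-(s * t)) *
      ((∫ z, f z * (∫ y, g y ∂((pinnedChain ω₂ lam β γ).transitionKernel N T T t.toNNReal z))
          ∂(pinnedChain ω₂ lam β γ).gibbsMeasure N T) -
        (∫ z, f z ∂(pinnedChain ω₂ lam β γ).gibbsMeasure N T) *
          (∫ z, g z ∂(pinnedChain ω₂ lam β γ).gibbsMeasure N T)) :=
    funext fun s => funext fun f => funext fun g => hlap s f g
  obtain rfl : cov = fun f g => (∫ z, f z * g z ∂(pinnedChain ω₂ lam β γ).gibbsMeasure N T) -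
      (∫ z, f z ∂(pinnedChain ω₂ lam β γ).gibbsMeasure N T) *
        (∫ z, g z ∂(pinnedChain ω₂ lam β γ).gibbsMeasure N T) := funext fun f => funext fun g => hcov f g
  obtain rfl : e = fun x z => z.2 x ^ 2 / 2 + (pinnedChain ω₂ lam β γ).U (z.1 x) +
      ∑ j : Fin N, ((if j.val = x.val + 1 then (pinnedChain ω₂ lam β γ).V (z.1 j - z.1 x) / 2 else 0) +
        (if x.val = j.val + 1 then (pinnedChain ω₂ lam β γ).V (z.1 x - z.1 j) / 2 else 0)) :=
    funext fun x => funext fun z => he x z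
  obtain ⟨-, hFI2, hCp, -⟩ := stub_feshbachIdentities ω₂ lam β γ hω hl hβ hγ T hT N hN
  exact rowSum_fixedN (ω₂ := ω₂) (lam := lam) (β := β) (γ := γ) (N := N) (T := T)
    (corr := fun f g t => (∫ z, f z * (∫ y, g y ∂((pinnedChain ω₂ lam β γ).transitionKernel N T T
      t.toNNReal z)) ∂(pinnedChain ω₂ lam β γ).gibbsMeasure N T) -
      (∫ z, f z ∂(pinnedChain ω₂ lam β γ).gibbsMeasure N T) * (∫ z, g z ∂(pinnedChain ω₂ lam β γ).gibbsMeasure N T))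
    (fun f => Iff.rfl) (fun s f g => rfl) (fun f g => rfl) (fun x z => rfl) hFI2
    hω hl.le hβ.le hT hN s hCp hrow' a ψ φ₀ φ₁ hdiv

end Summit.AtomisticToContinuum.FouriersLaw.Theorems.HonestZwanzig.Robin

end
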